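import Mathlib.Combinatorics.Additive.AP.Three.Behrend
import Literature.Combinatorics.Additive.TricoloredSumFreeLowerBound
import Literature.Combinatorics.Additive.TricoloredSumFreeLowerBoundPebody
import Literature.Computability.AlgebraicComplexity.LaserMethodTypes
import Literature.Computability.AlgebraicComplexity.MultinomialEntropy
import HarnessLib

/-!
# The Kleinberg–Sawin–Speyer lower bound for tricolored sum-free sets — proof

R. Kleinberg, W. Sawin, D. Speyer, *The growth rate of tri-colored sum-free sets*, Discrete
Analysis 2018:12 (arXiv:1607.00047; held `paper:arxiv-1607.00047`, pp. 5–9 of the text), §§3–4,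
with the distribution theorem (their Thm. 4) of Pebody (`TricoloredSumFreeLowerBoundPebody.lean`,
`Pebody.exists_coupling_of_antitone`). This file PROVES the theorem of the Abstract / Theorem 2 in
`δ`-form:

* `kleinbergSawinSpeyer2018` — for every integer `q ≥ 2` and `0 < δ < θ_q` (`θ_q = kssTheta q`,
  the constant of `TricoloredSumFreeLowerBound.lean`, `= q·J(q)`), for all large `n` there is a
  tricolored sum-free family (`IsTricoloredSumFree`, BCCGNSU Def. 3.1) in `(ℤ/q)ⁿ` with at least
  `(θ_q − δ)ⁿ` triples ("for any `δ > 0`, and `n` sufficiently large, there are tri-colored sum-free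
  sets in `C_qⁿ` of size `(θ−δ)ⁿ`. Our construction also works when `q` is not prime");
  `kleinbergSawinSpeyer2018_two` is the case `q = 2`, `θ₂ = 3/2^{2/3}` (`kssTheta_two`).

The printed Theorem 2 (`KleinbergSawinSpeyer2018_thm2`, the sharper
`θⁿ e^{−2√(2 log 2 log θ · n) − O_q(log n)}`) needs Behrend's bound with the sharp constant
`2√(2 log 2)` (and Elkin); Mathlib's `Behrend.roth_lower_bound` has the constant `4`, which gives
the subexponential factor `e^{−O(√n)}` used here and hence every `(θ − δ)ⁿ`, but not the printed
constant. That fact is NOT discharged here.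

## Structure (KSS §§3–4; namespace `KleinbergSawinSpeyer`)

* `exists_rho`, `entropy_psi`, `log_kssTheta_le_entropy` — §1/Lemma 5: a root `ρ ∈ (0,1)` of
  `Σ (3k − m) ρ^k = 0` (`m = q − 1`), `ψ_k = ρ^k/Z`, and `log θ_q ≤ H(ψ) = log (Z ρ^{−m/3})`
  (only this inequality, `kssTheta_le` at `x = ρ`, is needed for a lower bound).
* `exists_symmetric_weight` — Thm. 4: Pebody's coupling of `(ψ, ψ, ψ)`, symmetrised under `S₃`.
* `exists_integral_weight` — §4 ¶1, rounding: symmetric natural weights `Π` on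
  `T = {a + b + c = m}` with total `n₀` and marginal within `ε` of `ψ`. DEVIATION: instead of
  rounding to multiples of `1/n` for every `n` (error `O_q(1/n)`) we round ONCE and use the lengths
  `n₁ ∈ n₀ℕ`, padding by zeros to reach every `n` (`isTricoloredSumFree_pad`); this costs a factor
  `θ^{n₀}`, harmless for `(θ−δ)ⁿ`.
* `construction` — §4 at one length: `W` = the type class of the marginal, `V` = the typed
  support of `T` (triples of words of `W` with `x_ρ + y_ρ + z_ρ = m`); the free diagonal `Δ ⊆ V`
  is supplied by the tree's hashing theorem
  `Literature.Computability.AlgebraicComplexity.exists_free_diagonal_typedSupport` (BCS 1997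
  Thm. 15.39 with a Bertrand prime and a Salem–Spencer diagonal — the same random-hash/pruning
  argument as KSS Lemmas 11–12, with the fibre regularity of KSS p. 9 = BCS p. 381), and
  Lemma 8/9 (`sum_coe_eq_of_letterCount`, `coord_eq_of_ge`) turn `Δ` into the sum-free family
  `(x_δ, y_δ, z_δ + 1)`: a zero sum mod `q` gives coordinate sums `≡ −1`, so `≥ m`, so `= m`.
  Size: `|W| e^{−4√(3n log q + log 6)} ≤ 96 q |Δ|` (Behrend for `rothNumberNat`).
* `exp_entropy_le_card_typeClass` — Lemma 3 (method of types, lower half; the tree's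
  `exp_mul_sum_negMulLog_le_mul_multinomial`): `|W| ≥ e^{n H(μ/n)} (n+1)^{−q}`.
* `lower_bound` / `kleinbergSawinSpeyer2018` — Thm. 13/Thm. 2 in `δ`-form: continuity of `H` at
  `ψ`, the construction at `n₁ = ⌊n/n₀⌋ n₀`, and `q log(n+1) + O(√n) + O_q(1) ≤ δ₁ n` eventually.

## References

* [KleinbergSawinSpeyer2018] R. Kleinberg, W. Sawin, D. Speyer, Discrete Analysis 2018:12,
  doi:10.19086/da.3734 = arXiv:1607.00047: Abstract, §1 Thm. 2, §3 Lemma 3, Thm. 4, Lemma 5,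
  §4 Lemmas 8–12, Thm. 13.
* [Peabody2018] L. Pebody, Discrete Analysis 2018:13 (arXiv:1608.05740), Thm. 4.
* [BurgisserClausenShokrollahi1997] P. Bürgisser, M. Clausen, M. A. Shokrollahi, *Algebraic
  Complexity Theory*, Thm. 15.39, proof of Thm. 15.41 (the hashing theorem and fibre regularity,
  as formalised in `Literature/Computability/AlgebraicComplexity/LaserHashing.lean`,
  `LaserMethodTypes.lean`).
* F. A. Behrend, Proc. Nat. Acad. Sci. 32 (1946) — Mathlib `Behrend.roth_lower_bound`.
-/

noncomputable section

open Finset Real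

namespace Literature.Combinatorics.Additive

namespace KleinbergSawinSpeyer

open Literature.Computability.AlgebraicComplexity

/-! ### The constants `ρ`, `Z`, `ψ` and `log θ ≤ H(ψ)` (KSS §1, Lemma 5) -/

/-- The defining equation of `ρ`: `Σ_{k ≤ m} (3k − m) ρ^k = 0` has a root in `(0, 1)` (KSS §1: the
minimiser `ρ` of `(1 + σ + ⋯ + σ^m) σ^{−m/3}`; `ρ < 1` as the mean `m/3` is below `m/2`).
[cite: KleinbergSawinSpeyer2018, §1 (definition of ρ)] -/
theorem exists_rho (m : ℕ) (hm : 1 ≤ m) :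
    ∃ ρ : ℝ, 0 < ρ ∧ ρ < 1 ∧ ∑ k ∈ Finset.range (m + 1), (3 * (k:ℝ) - m) * ρ ^ k = 0 := by
  set g : ℝ → ℝ := fun x => ∑ k ∈ Finset.range (m + 1), (3 * (k:ℝ) - m) * x ^ k with hg
  have hcont : Continuous g :=
    continuous_finsetSum _ fun k _ => continuous_const.mul (continuous_pow k)
  have hg0 : g 0 = -m := by
    simp only [hg]
    rw [Finset.sum_eq_single 0 (fun k _ hk => by rw [zero_pow hk, mul_zero]) (by simp)]
    simp
  have hg1 : g 1 = (m:ℝ) * (m + 1) / 2 := by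
    simp only [hg, one_pow, mul_one]
    have h := Finset.sum_range_id_mul_two (m + 1)
    have h' : (∑ i ∈ Finset.range (m + 1), (i:ℝ)) * 2 = ((m:ℝ) + 1) * m := by
      have := congrArg (fun x : ℕ => (x:ℝ)) h
      push_cast at this
      simpa using this
    rw [Finset.sum_sub_distrib, ← Finset.mul_sum, Finset.sum_const, Finset.card_range,
      nsmul_eq_mul]
    push_cast
    nlinarith
  have hm0 : (0:ℝ) < m := by exact_mod_cast hm
  obtain ⟨ρ, ⟨hρ0, hρ1⟩, hρ⟩ := intermediate_value_Icc zero_le_one hcont.continuousOn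
    (show (0:ℝ) ∈ Set.Icc (g 0) (g 1) from ⟨by rw [hg0]; linarith, by rw [hg1]; positivity⟩)
  refine ⟨ρ, lt_of_le_of_ne hρ0 ?_, lt_of_le_of_ne hρ1 ?_, hρ⟩
  · rintro rfl; rw [hg0] at hρ; linarith
  · rintro rfl; rw [hg1] at hρ; nlinarith

/-- `θ_q ≥ 1` for `q ≥ 1` (the `i = 0` term of the geometric sum against `x^{−(q−1)/3} ≥ 1`).
[folklore] -/
theorem one_le_kssTheta {q : ℕ} (hq : 1 ≤ q) : 1 ≤ kssTheta q := by
  refine le_kssTheta hq fun x hx0 hx1 => ?_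
  have h1 : (1:ℝ) ≤ ∑ i ∈ Finset.range q, x ^ i := by
    have := Finset.single_le_sum (f := fun i => x ^ i) (fun i _ => pow_nonneg hx0.le i)
      (Finset.mem_range.2 hq)
    simpa using this
  have h2 : (1:ℝ) ≤ x ^ (-(((q:ℝ) - 1) / 3)) := by
    apply Real.one_le_rpow_of_pos_of_le_one_of_nonpos hx0 hx1.le
    have : (1:ℝ) ≤ q := by exact_mod_cast hq
    have : 0 ≤ ((q:ℝ) - 1) / 3 := by linarith
    linarith
  nlinarith

/-- **KSS Lemma 5** in the form used: with `Z = Σ_{k<q} ρ^k` and `ψ_k = ρ^k / Z`,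
`Σ_k −ψ_k log ψ_k = log (Z ρ^{−(q−1)/3})`, provided `Σ (3k − (q−1)) ρ^k = 0`.
[cite: KleinbergSawinSpeyer2018, Lemma 5] -/
theorem entropy_psi {q : ℕ} (hq : 1 ≤ q) {ρ : ℝ} (hρ0 : 0 < ρ)
    (hρ : ∑ k ∈ Finset.range q, (3 * (k:ℝ) - (q - 1)) * ρ ^ k = 0) :
    ∑ k : Fin q, Real.negMulLog (ρ ^ (k:ℕ) / ∑ j ∈ Finset.range q, ρ ^ j) =
      Real.log ((∑ j ∈ Finset.range q, ρ ^ j) * ρ ^ (-(((q:ℝ) - 1) / 3))) := by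
  set Z := ∑ j ∈ Finset.range q, ρ ^ j with hZ
  have hZpos : 0 < Z := by
    have := Finset.single_le_sum (f := fun i => ρ ^ i) (fun i _ => pow_nonneg hρ0.le i)
      (Finset.mem_range.2 hq)
    simp only [pow_zero] at this
    linarith
  -- `negMulLog (ρ^k/Z) = -(ρ^k/Z) (k log ρ - log Z)`
  have hterm : ∀ k : ℕ, Real.negMulLog (ρ ^ k / Z) = -(ρ ^ k / Z) * (k * Real.log ρ - Real.log Z) := by
    intro k
    rw [Real.negMulLog, Real.log_div (pow_pos hρ0 k).ne' hZpos.ne', Real.log_pow, neg_mul]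
  rw [Fin.sum_univ_eq_sum_range (fun k => Real.negMulLog (ρ ^ k / Z)) q]
  simp_rw [hterm]
  have hsplit : ∑ k ∈ Finset.range q, -(ρ ^ k / Z) * (k * Real.log ρ - Real.log Z) =
      -(Real.log ρ / Z) * ∑ k ∈ Finset.range q, (k:ℝ) * ρ ^ k +
        (Real.log Z / Z) * ∑ k ∈ Finset.range q, ρ ^ k := by
    rw [Finset.mul_sum, Finset.mul_sum, ← Finset.sum_add_distrib]
    exact Finset.sum_congr rfl fun k _ => by field_simp; ring
  have hmom : ∑ k ∈ Finset.range q, (k:ℝ) * ρ ^ k = ((q:ℝ) - 1) / 3 * Z := by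
    have : ∑ k ∈ Finset.range q, (3 * (k:ℝ) - (q - 1)) * ρ ^ k =
        3 * ∑ k ∈ Finset.range q, (k:ℝ) * ρ ^ k - ((q:ℝ) - 1) * Z := by
      rw [hZ, Finset.mul_sum, Finset.mul_sum, ← Finset.sum_sub_distrib]
      exact Finset.sum_congr rfl fun k _ => by ring
    linarith
  rw [hsplit, hmom, ← hZ, Real.log_mul hZpos.ne' (Real.rpow_pos_of_pos hρ0 _).ne',
    Real.log_rpow hρ0]
  field_simp
  ring

/-- `log θ_q ≤ H(ψ)`: the value of the minimised function at `ρ ∈ (0,1)` bounds `θ_q` above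
(`kssTheta_le`), and its logarithm is the entropy of `ψ` (`entropy_psi`).
[cite: KleinbergSawinSpeyer2018, §1 and Lemma 5] -/
theorem log_kssTheta_le_entropy {q : ℕ} (hq : 1 ≤ q) {ρ : ℝ} (hρ0 : 0 < ρ) (hρ1 : ρ < 1)
    (hρ : ∑ k ∈ Finset.range q, (3 * (k:ℝ) - (q - 1)) * ρ ^ k = 0) :
    Real.log (kssTheta q) ≤ ∑ k : Fin q, Real.negMulLog (ρ ^ (k:ℕ) / ∑ j ∈ Finset.range q, ρ ^ j) := by
  rw [entropy_psi hq hρ0 hρ]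
  exact Real.log_le_log (lt_of_lt_of_le one_pos (one_le_kssTheta hq)) (kssTheta_le hq hρ0 hρ1)

/-! ### A symmetric integral weight on `T` with marginal close to `ψ` (KSS Thm. 4 + §4, ¶1) -/

/-- Sums over the triples with prescribed first coordinate. [folklore] -/
theorem sum_filter_fst {q : ℕ} (F : Fin q × Fin q × Fin q → ℝ) (k : Fin q) :
    ∑ x ∈ Finset.univ.filter (fun x : Fin q × Fin q × Fin q => x.1 = k), F x = ∑ b, ∑ c, F (k, b, c) := by
  rw [Finset.sum_filter, Fintype.sum_prod_type, Finset.sum_eq_single k (fun a _ hak => by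
    simp [hak]) (by simp)]
  simp only [if_true, Fintype.sum_prod_type]

/-- Symmetrising and normalising Pebody's coupling: a symmetric probability weight on
`T = {a + b + c = m}` (inside `[0,m]³`) whose first marginal is `ψ/Z`.
[cite: KleinbergSawinSpeyer2018, Theorem 4] -/
theorem exists_symmetric_weight (m : ℕ) (ψ : ℕ → ℝ) (hψ : Antitone ψ)
    (hv : ∀ k, m < k → ψ k = 0)
    (hmom : 3 * ∑ k ∈ Finset.range (m + 1), (k:ℝ) * ψ k = m * ∑ k ∈ Finset.range (m + 1), ψ k)
    (hZ : 0 < ∑ k ∈ Finset.range (m + 1), ψ k) :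
    ∃ P : Fin (m + 1) × Fin (m + 1) × Fin (m + 1) → ℝ, (∀ x, 0 ≤ P x) ∧
      (∀ x, P x ≠ 0 → (x.1:ℕ) + x.2.1 + x.2.2 = m) ∧
      (∀ a b c, P (a, b, c) = P (b, a, c)) ∧ (∀ a b c, P (a, b, c) = P (a, c, b)) ∧
      ∀ k : Fin (m + 1), ∑ x ∈ Finset.univ.filter (fun x : Fin (m+1) × Fin (m+1) × Fin (m+1) => x.1 = k), P x =
        ψ k / ∑ j ∈ Finset.range (m + 1), ψ j := by
  obtain ⟨w, hw0, hws, hw1, hw2, hw3⟩ := Pebody.exists_coupling_of_antitone m ψ hψ hv hmom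
  set Z := ∑ k ∈ Finset.range (m + 1), ψ k with hZdef
  refine ⟨fun x => (w x.1 x.2.1 x.2.2 + w x.1 x.2.2 x.2.1 + w x.2.1 x.1 x.2.2 + w x.2.1 x.2.2 x.1 +
      w x.2.2 x.1 x.2.1 + w x.2.2 x.2.1 x.1) / (6 * Z), fun x => ?_, fun x hx => ?_,
    fun a b c => ?_, fun a b c => ?_, fun k => ?_⟩
  · have := hw0 x.1 x.2.1 x.2.2; have := hw0 x.1 x.2.2 x.2.1; have := hw0 x.2.1 x.1 x.2.2
    have := hw0 x.2.1 x.2.2 x.1; have := hw0 x.2.2 x.1 x.2.1; have := hw0 x.2.2 x.2.1 x.1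
    positivity
  · by_contra h
    apply hx
    dsimp only
    rw [hws _ _ _ h, hws _ _ _ (by omega), hws _ _ _ (by omega), hws _ _ _ (by omega),
      hws _ _ _ (by omega), hws _ _ _ (by omega)]
    simp
  · simp only; ring
  · simp only; ring
  · rw [sum_filter_fst]
    simp only [← Finset.sum_div]
    have e : ∀ G : ℕ → ℕ → ℝ, ∑ b : Fin (m + 1), ∑ c : Fin (m + 1), G b c =
        ∑ b ∈ Finset.range (m + 1), ∑ c ∈ Finset.range (m + 1), G b c := by
      intro G
      rw [Fin.sum_univ_eq_sum_range (fun b => ∑ c : Fin (m + 1), G b c) (m + 1)]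
      exact Finset.sum_congr rfl fun b _ => Fin.sum_univ_eq_sum_range (G b) (m + 1)
    have hS : ∑ b : Fin (m + 1), ∑ c : Fin (m + 1),
        (w k b c + w k c b + w b k c + w b c k + w c k b + w c b k) = 6 * ψ k := by
      simp only [Finset.sum_add_distrib]
      rw [e (fun b c => w k b c), e (fun b c => w k c b), e (fun b c => w b k c),
        e (fun b c => w b c k), e (fun b c => w c k b), e (fun b c => w c b k)]
      rw [hw1 k, Finset.sum_comm (f := fun b c => w k c b), hw1 k, hw2 k, hw3 k,
        Finset.sum_comm (f := fun b c => w c k b), hw2 k,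
        Finset.sum_comm (f := fun b c => w c b k), hw3 k]
      ring
    rw [hS]
    field_simp

/-- **Rounding to a lattice point** (KSS §4, first paragraph: "We can approximate `π` … by an
`S₃`-symmetric distribution `π'` where the probability of each element is an integer multiple of
`1/n`"): from a symmetric probability weight `P` on `T` we get symmetric natural weights `Pw` on `T`
with total `n₀` and first marginal within `ε` of that of `P`.
[cite: KleinbergSawinSpeyer2018, §4 (¶1)] -/
theorem exists_integral_weight {q : ℕ} (hq : 1 ≤ q) (P : Fin q × Fin q × Fin q → ℝ)
    (hP0 : ∀ x, 0 ≤ P x) (hPs : ∀ x, P x ≠ 0 → (x.1:ℕ) + x.2.1 + x.2.2 = q - 1)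
    (h12 : ∀ a b c, P (a, b, c) = P (b, a, c)) (h23 : ∀ a b c, P (a, b, c) = P (a, c, b))
    (hP1 : ∑ x, P x = 1) {ε : ℝ} (hε : 0 < ε) :
    ∃ (n₀ : ℕ) (Pw : Fin q × Fin q × Fin q → ℕ), 0 < n₀ ∧
      (∀ x, Pw x ≠ 0 → (x.1:ℕ) + x.2.1 + x.2.2 = q - 1) ∧
      (∀ a b c, Pw (a, b, c) = Pw (b, a, c)) ∧ (∀ a b c, Pw (a, b, c) = Pw (a, c, b)) ∧
      ∑ x, Pw x = n₀ ∧
      ∀ k : Fin q, |(∑ x ∈ Finset.univ.filter (fun x : Fin q × Fin q × Fin q => x.1 = k), (Pw x : ℝ)) / n₀ -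
        ∑ x ∈ Finset.univ.filter (fun x : Fin q × Fin q × Fin q => x.1 = k), P x| < ε := by
  classical
  -- the box, the simplex `T`, and the scale `N`
  set B : ℝ := (q:ℝ) ^ 3 with hB
  have hB1 : (1:ℝ) ≤ B := one_le_pow₀ (by exact_mod_cast hq)
  have hcardbox : (Fintype.card (Fin q × Fin q × Fin q) : ℝ) = B := by simp [hB]; ring
  haveI : Nonempty (Fin q × Fin q × Fin q) := ⟨(⟨0, by omega⟩, ⟨0, by omega⟩, ⟨0, by omega⟩)⟩
  set T := Finset.univ.filter (fun x : Fin q × Fin q × Fin q => (x.1:ℕ) + x.2.1 + x.2.2 = q - 1)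
    with hT
  have hTne : T.Nonempty := ⟨(⟨0, by omega⟩, ⟨0, by omega⟩, ⟨q - 1, by omega⟩), by simp [hT]⟩
  have hTc : 1 ≤ T.card := Finset.card_pos.2 hTne
  have hTcR : (1:ℝ) ≤ T.card := by exact_mod_cast hTc
  obtain ⟨N, hN⟩ : ∃ N : ℕ, B * (1 + B) / ε < N := exists_nat_gt _
  have hNpos : (0:ℝ) < N := lt_of_le_of_lt (by positivity) hN
  have hN0 : 0 < N := by exact_mod_cast hNpos
  -- rounding down
  set r : Fin q × Fin q × Fin q → ℕ := fun x => ⌊(N:ℝ) * P x⌋₊ with hr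
  have hr1 : ∀ x, (r x : ℝ) ≤ N * P x := fun x => Nat.floor_le (mul_nonneg hNpos.le (hP0 x))
  have hr2 : ∀ x, (N:ℝ) * P x < r x + 1 := fun x => Nat.lt_floor_add_one _
  have hrsum : ((∑ x, r x : ℕ) : ℝ) ≤ N := by
    push_cast
    calc ∑ x, (r x : ℝ) ≤ ∑ x, (N:ℝ) * P x := Finset.sum_le_sum fun x _ => hr1 x
      _ = N := by rw [← Finset.mul_sum, hP1, mul_one]
  have hrsumN : ∑ x, r x ≤ N := by exact_mod_cast hrsum
  set d : ℕ := N - ∑ x, r x with hd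
  have hdR : (d:ℝ) = N - ∑ x, (r x : ℝ) := by
    rw [hd, Nat.cast_sub hrsumN]; push_cast; rfl
  have hdlt : (d:ℝ) < B := by
    rw [hdR, ← hcardbox]
    have : (N:ℝ) - ∑ x, (r x : ℝ) = ∑ x, ((N:ℝ) * P x - r x) := by
      rw [Finset.sum_sub_distrib, ← Finset.mul_sum, hP1, mul_one]
    rw [this]
    calc ∑ x, ((N:ℝ) * P x - r x) < ∑ _x : Fin q × Fin q × Fin q, (1:ℝ) :=
          Finset.sum_lt_sum_of_nonempty Finset.univ_nonempty fun x _ => by linarith [hr2 x]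
      _ = Fintype.card (Fin q × Fin q × Fin q) := by simp
  have hrT : ∀ x, x ∉ T → r x = 0 := by
    intro x hx
    have : P x = 0 := by
      by_contra h
      exact hx (by simp only [hT, Finset.mem_filter, Finset.mem_univ, true_and]; exact hPs x h)
    simp [hr, this]
  -- the integral weights
  refine ⟨T.card * N, fun x => T.card * r x + (if x ∈ T then d else 0), Nat.mul_pos hTc hN0,
    fun x hx => ?_, fun a b c => ?_, fun a b c => ?_, ?_, fun k => ?_⟩
  · by_contra hsum
    have hxT : x ∉ T := by
      simp only [hT, Finset.mem_filter, Finset.mem_univ, true_and]; exact hsum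
    apply hx
    simp [hrT x hxT, hxT]
  · have hrr : r (a, b, c) = r (b, a, c) := by simp only [hr, h12]
    have hmm : ((a, b, c) ∈ T) ↔ ((b, a, c) ∈ T) := by
      simp only [hT, Finset.mem_filter, Finset.mem_univ, true_and]; omega
    dsimp only
    rw [hrr, if_congr hmm rfl rfl]
  · have hrr : r (a, b, c) = r (a, c, b) := by simp only [hr, h23]
    have hmm : ((a, b, c) ∈ T) ↔ ((a, c, b) ∈ T) := by
      simp only [hT, Finset.mem_filter, Finset.mem_univ, true_and]; omega
    dsimp only
    rw [hrr, if_congr hmm rfl rfl]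
  · rw [Finset.sum_add_distrib, ← Finset.mul_sum, Finset.sum_ite_mem, Finset.univ_inter,
      Finset.sum_const, smul_eq_mul, ← Nat.mul_add, hd, Nat.add_sub_of_le hrsumN]
  · -- the approximation
    have hn₀ : (0:ℝ) < (T.card * N : ℕ) := by positivity
    rw [div_sub' (ne_of_gt hn₀), abs_div, abs_of_pos hn₀, div_lt_iff₀ hn₀, Finset.mul_sum]
    push_cast
    rw [← Finset.sum_sub_distrib]
    calc |∑ x ∈ Finset.univ.filter (fun x : Fin q × Fin q × Fin q => x.1 = k),
          (((T.card : ℝ) * r x + (if x ∈ T then (d:ℝ) else 0)) - (T.card : ℝ) * N * P x)|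
        ≤ ∑ x ∈ Finset.univ.filter (fun x : Fin q × Fin q × Fin q => x.1 = k),
          |((T.card : ℝ) * r x + (if x ∈ T then (d:ℝ) else 0)) - (T.card : ℝ) * N * P x| :=
          Finset.abs_sum_le_sum_abs _ _
      _ ≤ ∑ _x ∈ Finset.univ.filter (fun x : Fin q × Fin q × Fin q => x.1 = k),
          (T.card : ℝ) * (1 + B) := by
          refine Finset.sum_le_sum fun x _ => ?_
          have h1 := hr1 x; have h2 := hr2 x
          have hite : 0 ≤ (if x ∈ T then (d:ℝ) else 0) ∧ (if x ∈ T then (d:ℝ) else 0) ≤ B := by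
            split_ifs
            · exact ⟨by positivity, hdlt.le⟩
            · exact ⟨le_rfl, by positivity⟩
          rw [abs_le]
          constructor <;> nlinarith [hite.1, hite.2, hTcR]
      _ ≤ B * ((T.card : ℝ) * (1 + B)) := by
          rw [Finset.sum_const, nsmul_eq_mul]
          refine mul_le_mul_of_nonneg_right ?_ (by positivity)
          rw [← hcardbox]
          exact_mod_cast Finset.card_filter_le _ _
      _ < ε * ((T.card : ℝ) * N) := by
          rw [div_lt_iff₀ hε] at hN
          nlinarith [hN, hTcR, hB1]

/-! ### The construction at one length (KSS §4: `W`, `V`, Lemmas 8–9, hashing) -/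

/-- Sums over the triples with prescribed first coordinate (any commutative monoid). [folklore] -/
theorem sum_filter_fst' {q : ℕ} {M : Type*} [AddCommMonoid M] (F : Fin q × Fin q × Fin q → M)
    (k : Fin q) : ∑ x ∈ Finset.univ.filter (fun x : Fin q × Fin q × Fin q => x.1 = k), F x =
      ∑ b, ∑ c, F (k, b, c) := by
  rw [Finset.sum_filter, Fintype.sum_prod_type, Finset.sum_eq_single k (fun a _ hak => by
    simp [hak]) (by simp)]
  simp only [if_true, Fintype.sum_prod_type]

/-- Sums over the triples with prescribed second coordinate. [folklore] -/
theorem sum_filter_snd' {q : ℕ} {M : Type*} [AddCommMonoid M] (F : Fin q × Fin q × Fin q → M)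
    (k : Fin q) : ∑ x ∈ Finset.univ.filter (fun x : Fin q × Fin q × Fin q => x.2.1 = k), F x =
      ∑ a, ∑ c, F (a, k, c) := by
  rw [Finset.sum_filter, Fintype.sum_prod_type]
  refine Finset.sum_congr rfl fun a _ => ?_
  rw [Fintype.sum_prod_type, Finset.sum_eq_single k (fun b _ hbk => by simp [hbk]) (by simp)]
  simp only [if_true]

/-- Sums over the triples with prescribed third coordinate. [folklore] -/
theorem sum_filter_thd' {q : ℕ} {M : Type*} [AddCommMonoid M] (F : Fin q × Fin q × Fin q → M)
    (k : Fin q) : ∑ x ∈ Finset.univ.filter (fun x : Fin q × Fin q × Fin q => x.2.2 = k), F x =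
      ∑ a, ∑ b, F (a, b, k) := by
  rw [Finset.sum_filter, Fintype.sum_prod_type]
  refine Finset.sum_congr rfl fun a _ => ?_
  rw [Fintype.sum_prod_type]
  refine Finset.sum_congr rfl fun b _ => ?_
  rw [Finset.sum_eq_single k (fun c _ hck => by simp [hck]) (by simp)]
  simp only [if_true]

/-- **KSS Lemma 8** (coordinate sums on a type class): `Σ_ρ u(ρ) = Σ_k k · μ(k)` for a word `u`
of type `μ`. [cite: KleinbergSawinSpeyer2018, Lemma 8] -/
theorem sum_coe_eq_of_letterCount {q n : ℕ} {u : Fin n → Fin q} {μ : Fin q → ℕ}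
    (hu : letterCount u = μ) : ∑ ρ, (u ρ : ℕ) = ∑ k : Fin q, (k:ℕ) * μ k := by
  classical
  rw [← Finset.sum_fiberwise Finset.univ u (fun ρ => (u ρ : ℕ))]
  refine Finset.sum_congr rfl fun k _ => ?_
  rw [Finset.sum_congr rfl fun ρ hρ => by rw [(Finset.mem_filter.1 hρ).2], Finset.sum_const,
    smul_eq_mul, ← hu, letterCount_apply, mul_comm]

/-- **KSS Lemma 9, the lifting step** ("we also have `a₀ + b₁ + c₂ = t` in `ℤⁿ`"): if three words
of type `μ` (`3 Σ k μ(k) = m n`) have coordinate sums `≥ m` everywhere, the sums are exactly `m`.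
[cite: KleinbergSawinSpeyer2018, Lemma 9] -/
theorem coord_eq_of_ge {m n : ℕ} {μ : Fin (m + 1) → ℕ}
    (h3 : 3 * ∑ k : Fin (m + 1), (k:ℕ) * μ k = m * n)
    {x y z : Fin n → Fin (m + 1)} (hx : letterCount x = μ) (hy : letterCount y = μ)
    (hz : letterCount z = μ) (hge : ∀ ρ, m ≤ (x ρ : ℕ) + y ρ + z ρ) :
    ∀ ρ, (x ρ : ℕ) + y ρ + z ρ = m := by
  have htot : ∑ ρ, ((x ρ : ℕ) + y ρ + z ρ) = ∑ _ρ : Fin n, m := by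
    rw [Finset.sum_add_distrib, Finset.sum_add_distrib, sum_coe_eq_of_letterCount hx,
      sum_coe_eq_of_letterCount hy, sum_coe_eq_of_letterCount hz, Finset.sum_const,
      Finset.card_univ, Fintype.card_fin, smul_eq_mul]
    linarith
  by_contra hne
  push Not at hne
  obtain ⟨ρ₀, hρ₀⟩ := hne
  have hlt : m < (x ρ₀ : ℕ) + y ρ₀ + z ρ₀ := lt_of_le_of_ne (hge ρ₀) (Ne.symm hρ₀)
  have := Finset.sum_lt_sum (s := Finset.univ) (fun ρ _ => hge ρ) ⟨ρ₀, Finset.mem_univ _, hlt⟩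
  rw [htot] at this
  exact lt_irrefl _ this

/-- The second marginal of a symmetric weight equals the first. [folklore] -/
theorem marginal_snd_eq {q : ℕ} (Pw : Fin q × Fin q × Fin q → ℕ)
    (h12 : ∀ a b c, Pw (a, b, c) = Pw (b, a, c)) (k : Fin q) :
    ∑ x ∈ Finset.univ.filter (fun x : Fin q × Fin q × Fin q => x.2.1 = k), Pw x =
      ∑ x ∈ Finset.univ.filter (fun x : Fin q × Fin q × Fin q => x.1 = k), Pw x := by
  rw [sum_filter_snd', sum_filter_fst']
  exact Finset.sum_congr rfl fun a _ => Finset.sum_congr rfl fun c _ => (h12 k a c).symm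

/-- The third marginal of a symmetric weight equals the first. [folklore] -/
theorem marginal_thd_eq {q : ℕ} (Pw : Fin q × Fin q × Fin q → ℕ)
    (h12 : ∀ a b c, Pw (a, b, c) = Pw (b, a, c)) (h23 : ∀ a b c, Pw (a, b, c) = Pw (a, c, b))
    (k : Fin q) :
    ∑ x ∈ Finset.univ.filter (fun x : Fin q × Fin q × Fin q => x.2.2 = k), Pw x =
      ∑ x ∈ Finset.univ.filter (fun x : Fin q × Fin q × Fin q => x.1 = k), Pw x := by
  rw [sum_filter_thd', sum_filter_fst']
  exact Finset.sum_congr rfl fun a _ => Finset.sum_congr rfl fun b _ => by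
    rw [h23 a b k, h12 a k b]

/-- The letter counts of a coordinate projection of a word of triples are the marginal counts.
[folklore] -/
theorem letterCount_proj {q n : ℕ} (ω : Fin n → Fin q × Fin q × Fin q) {Pw : Fin q × Fin q × Fin q → ℕ}
    (hω : letterCount ω = Pw) (p : Fin q × Fin q × Fin q → Fin q) :
    letterCount (fun ρ => p (ω ρ)) = fun k => ∑ x ∈ Finset.univ.filter (fun x => p x = k), Pw x := by
  classical
  funext k
  rw [letterCount_apply, Finset.card_eq_sum_card_fiberwise (f := ω)
    (t := Finset.univ.filter fun x => p x = k) (fun ρ hρ => by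
      simp only [Finset.coe_filter, Finset.mem_univ, true_and, Set.mem_setOf_eq] at hρ ⊢
      exact hρ)]
  refine Finset.sum_congr rfl fun x hx => ?_
  simp only [Finset.mem_filter, Finset.mem_univ, true_and] at hx
  rw [← hω, letterCount_apply]
  congr 1
  ext ρ
  simp only [Finset.mem_filter, Finset.mem_univ, true_and]
  exact ⟨fun h => h.2, fun h => ⟨by rw [h, hx], h⟩⟩

/-- **KSS §4, one length** (Lemmas 8, 9, 11, 12 and the expectation argument, through the tree's
hashing theorem): given symmetric natural weights `Pw` on the triples `a + b + c = q − 1` with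
total `n ≥ 1` and marginal `μ`, the triples `(x, y, z)` of words of type `μ` with
`x_ρ + y_ρ + z_ρ = q − 1` everywhere (`V`, here the typed support of `T`) contain a free diagonal
`Δ` (`exists_free_diagonal_typedSupport`: random hashing modulo a Bertrand prime and a
Salem–Spencer diagonal, with `rothNumberNat` bounded by Behrend's construction), and
`(x_δ, y_δ, z_δ + 1)_{δ ∈ Δ}` is tricolored sum-free in `(ℤ/q)ⁿ`: a zero sum modulo `q` forces
coordinate sums `≡ −1`, hence `≥ q − 1`, hence (Lemma 9, the words having equal coordinate totals)
`= q − 1`, i.e. a triple of `V`, which freeness pins down. Size: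
`|W_μ| · e^{−4√(3n log q + log 6)} ≤ 96 q · |Δ|`. [cite: KleinbergSawinSpeyer2018, §4 (Lemmas 8–12)] -/
theorem construction {q : ℕ} (hq : 2 ≤ q) {n : ℕ} (hn : 1 ≤ n) (Pw : Fin q × Fin q × Fin q → ℕ)
    (hsupp : ∀ x, Pw x ≠ 0 → (x.1:ℕ) + x.2.1 + x.2.2 = q - 1)
    (h12 : ∀ a b c, Pw (a, b, c) = Pw (b, a, c)) (h23 : ∀ a b c, Pw (a, b, c) = Pw (a, c, b))
    (hsum : ∑ x, Pw x = n) :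
    ∃ (s : ℕ) (a b c : Fin s → (Fin n → ZMod q)), IsTricoloredSumFree a b c ∧
      ((typeClass n (fun k : Fin q =>
          ∑ x ∈ Finset.univ.filter (fun x : Fin q × Fin q × Fin q => x.1 = k), Pw x)).card : ℝ) *
        Real.exp (-4 * Real.sqrt (3 * n * Real.log q + Real.log 6)) ≤ 96 * q * s := by
  classical
  obtain ⟨m, rfl⟩ : ∃ m, q = m + 1 := ⟨q - 1, by omega⟩
  simp only [Nat.add_sub_cancel] at hsupp
  set μ : Fin (m + 1) → ℕ := fun k =>
    ∑ x ∈ Finset.univ.filter (fun x : Fin (m+1) × Fin (m+1) × Fin (m+1) => x.1 = k), Pw x with hμ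
  set T : Finset (Fin (m+1) × Fin (m+1) × Fin (m+1)) :=
    Finset.univ.filter (fun x => (x.1:ℕ) + x.2.1 + x.2.2 = m) with hT
  have hmemT : ∀ x, x ∈ T ↔ (x.1:ℕ) + x.2.1 + x.2.2 = m := fun x => by simp [hT]
  -- a word of triples of type `Pw`, and its three projections
  obtain ⟨ω, hω⟩ := typeClass_nonempty n Pw hsum
  rw [mem_typeClass] at hω
  have hωT : ∀ ρ, ω ρ ∈ T := fun ρ => (hmemT _).2 (hsupp _ (by
    rw [← hω]; exact (letterCount_pos_of_apply ω ρ).ne'))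
  have hx : letterCount (fun ρ => (ω ρ).1) = μ := letterCount_proj ω hω Prod.fst
  have hy : letterCount (fun ρ => (ω ρ).2.1) = μ := by
    rw [letterCount_proj ω hω (fun x => x.2.1)]; funext k; exact marginal_snd_eq Pw h12 k
  have hz : letterCount (fun ρ => (ω ρ).2.2) = μ := by
    rw [letterCount_proj ω hω (fun x => x.2.2)]; funext k; exact marginal_thd_eq Pw h12 h23 k
  have hne : (typedSupport T n μ μ μ).Nonempty :=
    ⟨(fun ρ => (ω ρ).1, fun ρ => (ω ρ).2.1, fun ρ => (ω ρ).2.2),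
      mem_typedSupport.2 ⟨hx, hy, hz, fun ρ => hωT ρ⟩⟩
  -- the moment identity `3 Σ k μ(k) = m n`
  have h3 : 3 * ∑ k : Fin (m + 1), (k:ℕ) * μ k = m * n := by
    have e1 : ∑ k : Fin (m + 1), (k:ℕ) * μ k = ∑ x, (x.1 : ℕ) * Pw x := by
      simp only [hμ, Finset.mul_sum]
      rw [← Finset.sum_fiberwise Finset.univ (fun x : Fin (m+1) × Fin (m+1) × Fin (m+1) => x.1)
        (fun x => (x.1 : ℕ) * Pw x)]
      exact Finset.sum_congr rfl fun k _ => Finset.sum_congr rfl fun x hx => by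
        rw [(Finset.mem_filter.1 hx).2]
    have e2 : ∑ k : Fin (m + 1), (k:ℕ) * μ k = ∑ x, (x.2.1 : ℕ) * Pw x := by
      simp only [hμ]
      rw [Finset.sum_congr rfl fun k _ => by rw [← marginal_snd_eq Pw h12 k]]
      simp only [Finset.mul_sum]
      rw [← Finset.sum_fiberwise Finset.univ (fun x : Fin (m+1) × Fin (m+1) × Fin (m+1) => x.2.1)
        (fun x => (x.2.1 : ℕ) * Pw x)]
      exact Finset.sum_congr rfl fun k _ => Finset.sum_congr rfl fun x hx => by
        rw [(Finset.mem_filter.1 hx).2]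
    have e3 : ∑ k : Fin (m + 1), (k:ℕ) * μ k = ∑ x, (x.2.2 : ℕ) * Pw x := by
      simp only [hμ]
      rw [Finset.sum_congr rfl fun k _ => by rw [← marginal_thd_eq Pw h12 h23 k]]
      simp only [Finset.mul_sum]
      rw [← Finset.sum_fiberwise Finset.univ (fun x : Fin (m+1) × Fin (m+1) × Fin (m+1) => x.2.2)
        (fun x => (x.2.2 : ℕ) * Pw x)]
      exact Finset.sum_congr rfl fun k _ => Finset.sum_congr rfl fun x hx => by
        rw [(Finset.mem_filter.1 hx).2]
    have etot : ∑ x, ((x.1 : ℕ) + x.2.1 + x.2.2) * Pw x = m * n := by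
      rw [← hsum, Finset.mul_sum]
      refine Finset.sum_congr rfl fun x _ => ?_
      by_cases hPx : Pw x = 0
      · simp [hPx]
      · rw [hsupp x hPx]
    calc 3 * ∑ k : Fin (m + 1), (k:ℕ) * μ k
        = ∑ x, (x.1 : ℕ) * Pw x + ∑ x, (x.2.1 : ℕ) * Pw x + ∑ x, (x.2.2 : ℕ) * Pw x := by
          rw [← e1, ← e2, ← e3]; ring
      _ = m * n := by
          rw [← etot, ← Finset.sum_add_distrib, ← Finset.sum_add_distrib]
          exact Finset.sum_congr rfl fun x _ => by ring
  -- tightness data (`r = 1`, `b = m`)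
  let α : Fin (m + 1) → Fin 1 → ℤ := fun a _ => ((a : ℕ) : ℤ)
  let γ : Fin (m + 1) → Fin 1 → ℤ := fun c _ => ((c : ℕ) : ℤ) - m
  have hαinj : Function.Injective α := fun a a' h => by
    have := congrFun h 0; simp only [α, Nat.cast_inj] at this; exact Fin.ext this
  have hγinj : Function.Injective γ := fun a a' h => by
    have := congrFun h 0; simp only [γ, sub_left_inj, Nat.cast_inj] at this; exact Fin.ext this
  have hαb : ∀ a ρ, |α a ρ| ≤ m := fun a ρ => by
    simp only [α, Nat.abs_cast, Nat.cast_le]; omega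
  have htight : ∀ t ∈ T, ∀ ρ, α t.1 ρ + α t.2.1 ρ + γ t.2.2 ρ = 0 := by
    intro t ht ρ
    have := (hmemT t).1 ht
    simp only [α, γ]
    push_cast [← this]
    ring
  obtain ⟨Δ, hΔsub, hfree, f, hf1, hfΦ, hsize⟩ :=
    exists_free_diagonal_typedSupport T α α γ hαinj hαinj hγinj hαb hαb htight n μ μ μ hne
  -- the sum-free family indexed by `Δ`
  have hfreeΔ : IsTricoloredSumFree
      (fun δ : Δ => fun ρ => ((δ.1.1 ρ : ℕ) : ZMod (m + 1)))
      (fun δ : Δ => fun ρ => ((δ.1.2.1 ρ : ℕ) : ZMod (m + 1)))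
      (fun δ : Δ => fun ρ => ((δ.1.2.2 ρ : ℕ) : ZMod (m + 1)) + 1) := by
    intro i j k
    have hi := mem_typedSupport.1 (hΔsub i.2)
    have hj := mem_typedSupport.1 (hΔsub j.2)
    have hk := mem_typedSupport.1 (hΔsub k.2)
    constructor
    · intro h0
      have hge : ∀ ρ, m ≤ (i.1.1 ρ : ℕ) + j.1.2.1 ρ + k.1.2.2 ρ := by
        intro ρ
        have hρ := congrFun h0 ρ
        simp only [Pi.add_apply, Pi.zero_apply] at hρ
        have hcast : (((i.1.1 ρ : ℕ) + j.1.2.1 ρ + k.1.2.2 ρ + 1 : ℕ) : ZMod (m + 1)) = 0 := by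
          push_cast; rw [← hρ]; ring
        rw [ZMod.natCast_eq_zero_iff] at hcast
        have := Nat.le_of_dvd (Nat.succ_pos _) hcast
        omega
      have heq := coord_eq_of_ge h3 hi.1 hj.2.1 hk.2.2.1 hge
      have hmem : ∀ ρ, (i.1.1 ρ, j.1.2.1 ρ, k.1.2.2 ρ) ∈ T := fun ρ => (hmemT _).2 (heq ρ)
      obtain ⟨e1, e2⟩ := hfree i.1 i.2 j.1 j.2 k.1 k.2 hmem
      exact ⟨Subtype.ext e1, Subtype.ext e2⟩
    · rintro ⟨rfl, rfl⟩
      funext ρ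
      simp only [Pi.add_apply, Pi.zero_apply]
      have hm : (i.1.1 ρ : ℕ) + i.1.2.1 ρ + i.1.2.2 ρ = m := (hmemT _).1 (hi.2.2.2 ρ)
      have : (((i.1.1 ρ : ℕ) + i.1.2.1 ρ + i.1.2.2 ρ + 1 : ℕ) : ZMod (m + 1)) = 0 := by
        rw [hm]; exact ZMod.natCast_self (m + 1)
      push_cast at this
      rw [← this]; ring
  refine ⟨Δ.card, _, _, _, hfreeΔ.comp (e := (Δ.equivFin).symm) (Δ.equivFin).symm.injective, ?_⟩
  -- the size bound
  have hmin : min (typeClass n μ).card (min (typeClass n μ).card (typeClass n μ).card) =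
      (typeClass n μ).card := by simp
  rw [hmin] at hsize
  set W := (typeClass n μ).card with hW
  set f' := max f m with hf'
  have hf'1 : 1 ≤ f' := le_trans hf1 (le_max_left _ _)
  have hff' : f ≤ f' := le_max_left _ _
  have hf'le : f' ≤ f * (m + 1) := by
    refine max_le ?_ ?_
    · exact Nat.le_mul_of_pos_right f (Nat.succ_pos m)
    · calc m ≤ 1 * (m + 1) := by omega
        _ ≤ f * (m + 1) := Nat.mul_le_mul_right _ hf1
  -- Behrend's bound for the Salem–Spencer loss
  have hB := Behrend.roth_lower_bound (N := 3 * f')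
  have hsizeR : (W : ℝ) * f * rothNumberNat (3 * f') ≤ 288 * (f':ℝ) ^ 2 * Δ.card := by
    exact_mod_cast hsize
  set E' := Real.exp (-4 * Real.sqrt (Real.log ((3 * f' : ℕ) : ℝ))) with hE'
  have h1 : (W:ℝ) * f * (((3 * f' : ℕ) : ℝ) * E') ≤ 288 * (f':ℝ) ^ 2 * Δ.card :=
    le_trans (mul_le_mul_of_nonneg_left hB (by positivity)) hsizeR
  -- `log (3 f') ≤ 3 n log q + log 6`
  have hfcard : f ≤ (m + 1) ^ (3 * n) := by
    refine hfΦ.trans ((Finset.card_le_univ _).trans ?_)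
    simp only [Fintype.card_prod, Fintype.card_fun, Fintype.card_fin]
    rw [pow_mul']; ring_nf; exact le_rfl
  have hmle : m ≤ (m + 1) ^ (3 * n) :=
    (Nat.le_succ m).trans (Nat.le_self_pow (by omega) (m + 1))
  have hf'le2 : f' ≤ (m + 1) ^ (3 * n) := max_le hfcard hmle
  have hlog : Real.log ((3 * f' : ℕ) : ℝ) ≤ 3 * n * Real.log ((m + 1 : ℕ) : ℝ) + Real.log 6 := by
    have hpos : (0:ℝ) < ((3 * f' : ℕ) : ℝ) := by positivity
    have hle : ((3 * f' : ℕ) : ℝ) ≤ 6 * ((m + 1 : ℕ) : ℝ) ^ (3 * n) := by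
      have : ((f' : ℕ) : ℝ) ≤ ((m + 1 : ℕ) : ℝ) ^ (3 * n) := by exact_mod_cast hf'le2
      push_cast at this ⊢
      linarith [this]
    calc Real.log ((3 * f' : ℕ) : ℝ) ≤ Real.log (6 * ((m + 1 : ℕ) : ℝ) ^ (3 * n)) :=
          Real.log_le_log hpos hle
      _ = 3 * n * Real.log ((m + 1 : ℕ) : ℝ) + Real.log 6 := by
          rw [Real.log_mul (by norm_num) (by positivity), Real.log_pow]; push_cast; ring
  have hEE' : Real.exp (-4 * Real.sqrt (3 * n * Real.log ((m + 1 : ℕ) : ℝ) + Real.log 6)) ≤ E' := by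
    rw [hE']
    exact Real.exp_le_exp.2 (by linarith [Real.sqrt_le_sqrt hlog])
  -- cancel `f · 3f'`
  have key : (W:ℝ) * E' * ((f:ℝ) * (3 * f')) ≤ (96 * ((m + 1 : ℕ) : ℝ) * Δ.card) * ((f:ℝ) * (3 * f')) := by
    have hf'R : ((f':ℕ):ℝ) ≤ (f:ℝ) * ((m + 1 : ℕ) : ℝ) := by exact_mod_cast hf'le
    have hΔ0 : (0:ℝ) ≤ Δ.card := Nat.cast_nonneg _
    calc (W:ℝ) * E' * ((f:ℝ) * (3 * f')) = (W:ℝ) * f * (((3 * f' : ℕ) : ℝ) * E') := by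
          push_cast; ring
      _ ≤ 288 * (f':ℝ) ^ 2 * Δ.card := h1
      _ = (288 * (f':ℝ) * Δ.card) * f' := by ring
      _ ≤ (288 * (f':ℝ) * Δ.card) * ((f:ℝ) * ((m + 1 : ℕ) : ℝ)) :=
          mul_le_mul_of_nonneg_left hf'R (by positivity)
      _ = (96 * ((m + 1 : ℕ) : ℝ) * Δ.card) * ((f:ℝ) * (3 * f')) := by ring
  have hpos : (0:ℝ) < (f:ℝ) * (3 * f') := by
    have : (1:ℝ) ≤ f := by exact_mod_cast hf1
    have : (1:ℝ) ≤ f' := by exact_mod_cast hf'1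
    positivity
  have hWE : (W:ℝ) * E' ≤ 96 * ((m + 1 : ℕ) : ℝ) * Δ.card := le_of_mul_le_mul_right key hpos
  calc (W:ℝ) * Real.exp (-4 * Real.sqrt (3 * n * Real.log ((m + 1 : ℕ) : ℝ) + Real.log 6))
      ≤ (W:ℝ) * E' := mul_le_mul_of_nonneg_left hEE' (Nat.cast_nonneg _)
    _ ≤ 96 * ((m + 1 : ℕ) : ℝ) * Δ.card := hWE

/-! ### Assembly: entropy bound, padding, asymptotics -/

/-- The type class of `μ` has at least `e^{n H(μ/n)} / (n+1)^q` elements (method of types, lower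
bound; the tree's `exp_mul_sum_negMulLog_le_mul_multinomial`). [folklore] -/
theorem exp_entropy_le_card_typeClass {q n : ℕ} (μ : Fin q → ℕ) (hμ : ∑ k, μ k = n) :
    Real.exp (n * ∑ k, Real.negMulLog ((μ k : ℝ) / n)) ≤ ((n:ℝ) + 1) ^ q * (typeClass n μ).card := by
  have h := exp_mul_sum_negMulLog_le_mul_multinomial μ hμ
  rw [Fintype.card_fin, ← card_typeClass_eq_multinomial n μ hμ] at h
  exact h

/-- Zero-padding `(ℤ/q)^{n₁} → (ℤ/q)ⁿ`, `n₁ ≤ n`, is an injective homomorphism, so tricolored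
sum-free families lift to any larger dimension. [folklore] -/
theorem isTricoloredSumFree_pad {q n₁ n : ℕ} (h : n₁ ≤ n) {s : ℕ} {a b c : Fin s → (Fin n₁ → ZMod q)}
    (habc : IsTricoloredSumFree a b c) :
    ∃ a' b' c' : Fin s → (Fin n → ZMod q), IsTricoloredSumFree a' b' c' := by
  let pad : (Fin n₁ → ZMod q) →+ (Fin n → ZMod q) :=
    { toFun := fun x i => if hi : (i:ℕ) < n₁ then x ⟨i, hi⟩ else 0
      map_zero' := by funext i; simp
      map_add' := fun x y => by funext i; simp only [Pi.add_apply]; split_ifs <;> simp }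
  have hinj : Function.Injective pad := by
    intro x y hxy
    funext j
    have := congrFun hxy (Fin.castLE h j)
    simpa [pad] using this
  exact ⟨_, _, _, habc.map pad hinj⟩

/-- `K √n + K' ≤ δ n` for all large `n`. [folklore] -/
theorem eventually_sqrt_le_linear {K K' δ : ℝ} (hK : 0 ≤ K) (hK' : 0 ≤ K') (hδ : 0 < δ) :
    ∃ N : ℕ, ∀ n : ℕ, N ≤ n → K * Real.sqrt n + K' ≤ δ * n := by
  obtain ⟨N, hN⟩ := exists_nat_gt (((K + K') / δ) ^ 2)
  refine ⟨max N 1, fun n hn => ?_⟩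
  have hn1 : (1:ℝ) ≤ n := by exact_mod_cast le_trans (le_max_right _ _) hn
  have hnN : ((K + K') / δ) ^ 2 ≤ n := hN.le.trans (by exact_mod_cast le_trans (le_max_left _ _) hn)
  have hsq : (K + K') / δ ≤ Real.sqrt n := by
    rw [← Real.sqrt_sq (div_nonneg (by linarith) hδ.le)]
    exact Real.sqrt_le_sqrt hnN
  have hs1 : 1 ≤ Real.sqrt n := by rw [← Real.sqrt_one]; exact Real.sqrt_le_sqrt hn1
  have hkey : K + K' ≤ δ * Real.sqrt n := by rwa [div_le_iff₀ hδ, mul_comm] at hsq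
  calc K * Real.sqrt n + K' ≤ K * Real.sqrt n + K' * Real.sqrt n := by nlinarith
    _ = (K + K') * Real.sqrt n := by ring
    _ ≤ (δ * Real.sqrt n) * Real.sqrt n := mul_le_mul_of_nonneg_right hkey (by positivity)
    _ = δ * n := by rw [mul_assoc, Real.mul_self_sqrt (by positivity)]

/-- **Kleinberg–Sawin–Speyer 2018, the lower bound in `δ`-form** (Abstract / Theorem 2 up to the
subexponential factor): for every integer `q ≥ 2` and `0 < δ < θ_q`, for all large `n` there is a
tricolored sum-free family in `(ℤ/q)ⁿ` with at least `(θ_q − δ)ⁿ` triples. Proof = KSS §4 at the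
lengths `n₁ ∈ n₀ℕ` (`construction` with the rounded symmetric distribution of Pebody's Theorem 4,
the method-of-types size of `W`, and `log θ ≤ H(ψ)`), padded by zeros to every `n`.
[cite: KleinbergSawinSpeyer2018, Theorem 2 and §4 (Theorem 13)] -/
theorem lower_bound (q : ℕ) (hq : 2 ≤ q) (δ : ℝ) (hδ : 0 < δ) (hδθ : δ < kssTheta q) :
    ∃ n₀ : ℕ, ∀ n : ℕ, n₀ ≤ n → ∃ (s : ℕ) (a b c : Fin s → (Fin n → ZMod q)),
      IsTricoloredSumFree a b c ∧ (kssTheta q - δ) ^ n ≤ (s : ℝ) := by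
  classical
  -- `√(a + b) ≤ √a + √b`
  have hsub : ∀ a b : ℝ, 0 ≤ a → 0 ≤ b → Real.sqrt (a + b) ≤ Real.sqrt a + Real.sqrt b := by
    intro a b ha hb
    rw [Real.sqrt_le_iff]
    refine ⟨by positivity, ?_⟩
    nlinarith [Real.sq_sqrt ha, Real.sq_sqrt hb, Real.sqrt_nonneg a, Real.sqrt_nonneg b]
  obtain ⟨m, rfl⟩ : ∃ m, q = m + 1 := ⟨q - 1, by omega⟩
  have hm : 1 ≤ m := by omega
  have hq1 : 1 ≤ m + 1 := by omega
  -- the constants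
  set θ := kssTheta (m + 1) with hθ
  have hθ1 : 1 ≤ θ := one_le_kssTheta hq1
  have hθδ : 0 < θ - δ := by linarith
  have hlogθ : 0 ≤ Real.log θ := Real.log_nonneg hθ1
  obtain ⟨ρ, hρ0, hρ1, hρ⟩ := exists_rho m hm
  have hρ' : ∑ k ∈ Finset.range (m + 1), (3 * (k:ℝ) - ((m + 1 : ℕ) - 1)) * ρ ^ k = 0 := by
    push_cast; simpa using hρ
  set Z := ∑ j ∈ Finset.range (m + 1), ρ ^ j with hZ
  have hZpos : 0 < Z := by
    have := Finset.single_le_sum (f := fun i => ρ ^ i) (fun i _ => pow_nonneg hρ0.le i)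
      (Finset.mem_range.2 hq1)
    simp only [pow_zero] at this
    rw [hZ]; linarith
  set p₀ : Fin (m + 1) → ℝ := fun k => ρ ^ (k:ℕ) / Z with hp₀
  have hH₀ : Real.log θ ≤ ∑ k, Real.negMulLog (p₀ k) := log_kssTheta_le_entropy hq1 hρ0 hρ1 hρ'
  -- `δ₁`
  set δ₁ := (Real.log θ - Real.log (θ - δ)) / 2 with hδ₁def
  have hδ₁ : 0 < δ₁ := by
    have : Real.log (θ - δ) < Real.log θ := Real.log_lt_log hθδ (by linarith)
    rw [hδ₁def]; linarith
  have hlogθδ : Real.log (θ - δ) = Real.log θ - 2 * δ₁ := by rw [hδ₁def]; ring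
  -- continuity of the entropy at `p₀`
  have hcont : Continuous fun p : Fin (m + 1) → ℝ => ∑ k, Real.negMulLog (p k) :=
    continuous_finsetSum _ fun k _ => Real.continuous_negMulLog.comp (continuous_apply k)
  obtain ⟨η, hη, hηH⟩ := Metric.continuous_iff.1 hcont p₀ δ₁ hδ₁
  -- the distribution: Pebody, symmetrised, rounded
  set ψ : ℕ → ℝ := fun k => if k ≤ m then ρ ^ k else 0 with hψ
  have hψanti : Antitone ψ := by
    intro a b hab
    simp only [hψ]
    split_ifs with h1 h2 h2
    · exact pow_le_pow_of_le_one hρ0.le hρ1.le hab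
    · omega
    · positivity
    · exact le_rfl
  have hψv : ∀ k, m < k → ψ k = 0 := fun k hk => by simp [hψ, Nat.not_le.2 hk]
  have hψr : ∀ k ∈ Finset.range (m + 1), ψ k = ρ ^ k := fun k hk => by
    simp [hψ, Nat.lt_succ_iff.1 (Finset.mem_range.1 hk)]
  have hψZ : ∑ k ∈ Finset.range (m + 1), ψ k = Z := Finset.sum_congr rfl hψr
  have hψmom : 3 * ∑ k ∈ Finset.range (m + 1), (k:ℝ) * ψ k = m * ∑ k ∈ Finset.range (m + 1), ψ k := by
    rw [hψZ, Finset.sum_congr rfl fun k hk => by rw [hψr k hk]]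
    have : ∑ k ∈ Finset.range (m + 1), (3 * (k:ℝ) - m) * ρ ^ k =
        3 * ∑ k ∈ Finset.range (m + 1), (k:ℝ) * ρ ^ k - m * Z := by
      rw [hZ, Finset.mul_sum, Finset.mul_sum, ← Finset.sum_sub_distrib]
      exact Finset.sum_congr rfl fun k _ => by ring
    linarith
  obtain ⟨P, hP0, hPs, hP12, hP23, hPmarg⟩ :=
    exists_symmetric_weight m ψ hψanti hψv hψmom (by rw [hψZ]; exact hZpos)
  have hPmarg' : ∀ k : Fin (m + 1),
      ∑ x ∈ Finset.univ.filter (fun x : Fin (m+1) × Fin (m+1) × Fin (m+1) => x.1 = k), P x = p₀ k := by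
    intro k
    rw [hPmarg k, hψZ, hp₀]
    simp only [hψ, if_pos (Nat.lt_succ_iff.1 k.is_lt)]
  have hP1 : ∑ x, P x = 1 := by
    rw [← Finset.sum_fiberwise Finset.univ (fun x : Fin (m+1) × Fin (m+1) × Fin (m+1) => x.1) P]
    rw [Finset.sum_congr rfl fun k _ => hPmarg' k]
    simp only [hp₀]
    rw [← Finset.sum_div, Fin.sum_univ_eq_sum_range (fun k => ρ ^ k) (m + 1), ← hZ, div_self hZpos.ne']
  obtain ⟨n₀, Pw, hn₀, hsupp, h12, h23, hsum, happrox⟩ :=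
    exists_integral_weight hq1 P hP0 hPs hP12 hP23 hP1 hη
  -- the empirical distribution `p` and its entropy
  set μ : Fin (m + 1) → ℕ := fun k =>
    ∑ x ∈ Finset.univ.filter (fun x : Fin (m+1) × Fin (m+1) × Fin (m+1) => x.1 = k), Pw x with hμ
  set p : Fin (m + 1) → ℝ := fun k => (μ k : ℝ) / n₀ with hp
  have hpdist : dist p p₀ < η := by
    rw [dist_pi_lt_iff hη]
    intro k
    rw [Real.dist_eq, hp, ← hPmarg' k]
    simp only [hμ]
    push_cast
    exact happrox k
  have hHp : Real.log θ - δ₁ ≤ ∑ k, Real.negMulLog (p k) := by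
    have := hηH p hpdist
    rw [Real.dist_eq, abs_lt] at this
    linarith
  -- the eventual inequality
  set K : ℝ := 2 * (m + 1) + 4 * Real.sqrt (3 * Real.log (m + 1 : ℕ)) with hK
  set K' : ℝ := 2 * (m + 1) + Real.log (96 * (m + 1 : ℕ)) + n₀ * Real.log θ + 4 * Real.sqrt (Real.log 6)
    with hK'
  have hlogq : 0 ≤ Real.log (m + 1 : ℕ) := Real.log_nonneg (by exact_mod_cast hq1)
  have hKnn : 0 ≤ K := by rw [hK]; positivity
  have hK'nn : 0 ≤ K' := by
    have : 0 ≤ Real.log (96 * (m + 1 : ℕ)) :=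
      Real.log_nonneg (by push_cast; linarith [(Nat.cast_nonneg m : (0:ℝ) ≤ m)])
    rw [hK']; positivity
  obtain ⟨N, hN⟩ := eventually_sqrt_le_linear hKnn hK'nn hδ₁
  refine ⟨max N n₀, fun n hn => ?_⟩
  have hnN : N ≤ n := le_trans (le_max_left _ _) hn
  have hnn₀ : n₀ ≤ n := le_trans (le_max_right _ _) hn
  have hn1 : 1 ≤ n := le_trans hn₀ hnn₀
  -- the length `n₁ = s n₀ ≤ n`
  set s := n / n₀ with hs
  have hs1 : 1 ≤ s := (Nat.one_le_div_iff hn₀).2 hnn₀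
  set n₁ := s * n₀ with hn₁
  have hn₁n : n₁ ≤ n := Nat.div_mul_le_self n n₀
  have hn₁1 : 1 ≤ n₁ := Nat.mul_pos hs1 hn₀
  have hn₁lt : n < n₁ + n₀ := by rw [hn₁, hs]; exact Nat.lt_div_mul_add hn₀
  -- the construction at length `n₁` with weights `s · Pw`
  obtain ⟨sz, a, b, c, hfree, hbound⟩ := construction (q := m + 1) (by omega) hn₁1 (fun x => s * Pw x)
    (fun x hx => by simpa using hsupp x (fun h => hx (by simp [h])))
    (fun a b c => by simp only [h12]) (fun a b c => by simp only [h23])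
    (by rw [← Finset.mul_sum, hsum])
  obtain ⟨a', b', c', hfree'⟩ := isTricoloredSumFree_pad hn₁n hfree
  refine ⟨sz, a', b', c', hfree', ?_⟩
  -- sizes
  have hμ' : (fun k : Fin (m + 1) =>
      ∑ x ∈ Finset.univ.filter (fun x : Fin (m+1) × Fin (m+1) × Fin (m+1) => x.1 = k), s * Pw x) =
      fun k => s * μ k := by
    funext k; simp only [hμ, Finset.mul_sum]
  rw [hμ'] at hbound
  have hμsum : ∑ k, s * μ k = n₁ := by
    rw [← Finset.mul_sum, hn₁]
    congr 1
    simp only [hμ]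
    rw [Finset.sum_fiberwise Finset.univ (fun x : Fin (m+1) × Fin (m+1) × Fin (m+1) => x.1) Pw, hsum]
  have hW := exp_entropy_le_card_typeClass (fun k => s * μ k) hμsum
  have hpn₁ : (fun k => ((s * μ k : ℕ) : ℝ) / n₁) = p := by
    funext k
    simp only [hp, hn₁]
    have : (s:ℝ) ≠ 0 := by exact_mod_cast (by omega : s ≠ 0)
    have : (n₀:ℝ) ≠ 0 := by exact_mod_cast hn₀.ne'
    push_cast
    field_simp
  rw [show (fun k => Real.negMulLog (((s * μ k : ℕ) : ℝ) / n₁)) =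
      fun k => Real.negMulLog (p k) from by rw [← hpn₁]] at hW
  -- now the real inequality
  have hsz : Real.exp (n₁ * ∑ k, Real.negMulLog (p k)) *
      Real.exp (-4 * Real.sqrt (3 * n₁ * Real.log (m + 1 : ℕ) + Real.log 6)) ≤
      ((n₁:ℝ) + 1) ^ (m + 1) * (96 * (m + 1 : ℕ) * sz) := by
    calc _ ≤ ((n₁:ℝ) + 1) ^ (m + 1) * (typeClass n₁ (fun k => s * μ k)).card *
          Real.exp (-4 * Real.sqrt (3 * n₁ * Real.log (m + 1 : ℕ) + Real.log 6)) :=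
          mul_le_mul_of_nonneg_right hW (Real.exp_pos _).le
      _ ≤ ((n₁:ℝ) + 1) ^ (m + 1) * (96 * (m + 1 : ℕ) * sz) := by
          rw [mul_assoc]
          exact mul_le_mul_of_nonneg_left hbound (by positivity)
  -- logarithmic bookkeeping
  have hn₁R : (n₁:ℝ) ≤ n := by exact_mod_cast hn₁n
  have hn₁R' : (n:ℝ) - n₀ ≤ n₁ := by
    have : (n:ℝ) < n₁ + n₀ := by exact_mod_cast hn₁lt
    linarith
  have hjunk := hN n hnN
  have hsqrt1 : Real.sqrt (3 * n * Real.log (m + 1 : ℕ) + Real.log 6) ≤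
      Real.sqrt (3 * Real.log (m + 1 : ℕ)) * Real.sqrt n + Real.sqrt (Real.log 6) := by
    calc Real.sqrt (3 * n * Real.log (m + 1 : ℕ) + Real.log 6)
        ≤ Real.sqrt (3 * n * Real.log (m + 1 : ℕ)) + Real.sqrt (Real.log 6) :=
          hsub _ _ (by positivity) (Real.log_nonneg (by norm_num))
      _ = Real.sqrt (3 * Real.log (m + 1 : ℕ)) * Real.sqrt n + Real.sqrt (Real.log 6) := by
          rw [← Real.sqrt_mul (by positivity)]; ring_nf
  have hlogn : Real.log ((n:ℝ) + 1) ≤ 2 * Real.sqrt n + 2 := by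
    have h1 : Real.log ((n:ℝ) + 1) ≤ ((n:ℝ) + 1) ^ (1/2 : ℝ) / (1/2 : ℝ) :=
      Real.log_le_rpow_div (by positivity) (by norm_num)
    have h2 : ((n:ℝ) + 1) ^ (1/2 : ℝ) = Real.sqrt (n + 1) := by rw [Real.sqrt_eq_rpow]
    have h3 : Real.sqrt ((n:ℝ) + 1) ≤ Real.sqrt n + 1 := by
      have := hsub _ _ (Nat.cast_nonneg n) zero_le_one
      rwa [Real.sqrt_one] at this
    rw [h2] at h1
    linarith
  -- exponent comparison
  have hexp : (n:ℝ) * Real.log (θ - δ) + Real.log (96 * (m + 1 : ℕ)) + ((m:ℝ) + 1) * Real.log ((n₁:ℝ) + 1) ≤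
      n₁ * ∑ k, Real.negMulLog (p k) - 4 * Real.sqrt (3 * n₁ * Real.log (m + 1 : ℕ) + Real.log 6) := by
    have hm1 : (0:ℝ) ≤ (m:ℝ) + 1 := by positivity
    have e1 : (n₁:ℝ) * (Real.log θ - δ₁) ≤ n₁ * ∑ k, Real.negMulLog (p k) :=
      mul_le_mul_of_nonneg_left hHp (by positivity)
    have e2a : ((n:ℝ) - n₀) * Real.log θ ≤ (n₁:ℝ) * Real.log θ :=
      mul_le_mul_of_nonneg_right hn₁R' hlogθ
    have e2b : (n₁:ℝ) * δ₁ ≤ (n:ℝ) * δ₁ := mul_le_mul_of_nonneg_right hn₁R hδ₁.le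
    have e3' : (3:ℝ) * n₁ * Real.log (m + 1 : ℕ) ≤ 3 * n * Real.log (m + 1 : ℕ) :=
      mul_le_mul_of_nonneg_right (by linarith) hlogq
    have e3 : Real.sqrt (3 * n₁ * Real.log (m + 1 : ℕ) + Real.log 6) ≤
        Real.sqrt (3 * n * Real.log (m + 1 : ℕ) + Real.log 6) :=
      Real.sqrt_le_sqrt (by linarith)
    have e4 : Real.log ((n₁:ℝ) + 1) ≤ Real.log ((n:ℝ) + 1) :=
      Real.log_le_log (by positivity) (by linarith)
    have f1 : ((m:ℝ) + 1) * Real.log ((n₁:ℝ) + 1) ≤ ((m:ℝ) + 1) * Real.log ((n:ℝ) + 1) :=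
      mul_le_mul_of_nonneg_left e4 hm1
    have f2 : ((m:ℝ) + 1) * Real.log ((n:ℝ) + 1) ≤ ((m:ℝ) + 1) * (2 * Real.sqrt n + 2) :=
      mul_le_mul_of_nonneg_left hlogn hm1
    rw [hK, hK'] at hjunk
    rw [hlogθδ]
    linarith [hjunk, hsqrt1, e1, e2a, e2b, e3, f1, f2]
  -- conclude
  have hpos96 : (0:ℝ) < 96 * (m + 1 : ℕ) := by positivity
  have hfin : (θ - δ) ^ n * (((n₁:ℝ) + 1) ^ (m + 1) * (96 * (m + 1 : ℕ))) ≤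
      ((n₁:ℝ) + 1) ^ (m + 1) * (96 * (m + 1 : ℕ) * sz) := by
    refine le_trans ?_ hsz
    rw [← Real.exp_log (pow_pos hθδ n), ← Real.exp_log (by positivity :
      (0:ℝ) < ((n₁:ℝ) + 1) ^ (m + 1) * (96 * (m + 1 : ℕ))), ← Real.exp_add, ← Real.exp_add]
    refine Real.exp_le_exp.2 ?_
    rw [Real.log_pow, Real.log_mul (by positivity) hpos96.ne', Real.log_pow]
    have hc : (((m + 1 : ℕ)) : ℝ) * Real.log ((n₁:ℝ) + 1) = ((m:ℝ) + 1) * Real.log ((n₁:ℝ) + 1) := by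
      push_cast; ring
    linarith [hexp, hc]
  have hpos2 : (0:ℝ) < ((n₁:ℝ) + 1) ^ (m + 1) * (96 * (m + 1 : ℕ)) := by positivity
  rw [show ((n₁:ℝ) + 1) ^ (m + 1) * (96 * (m + 1 : ℕ) * sz) =
    (sz:ℝ) * (((n₁:ℝ) + 1) ^ (m + 1) * (96 * (m + 1 : ℕ))) by ring] at hfin
  exact le_of_mul_le_mul_right hfin hpos2

end KleinbergSawinSpeyer

/-- **Kleinberg–Sawin–Speyer 2018** (Abstract; Theorem 2 up to the subexponential factor): for
every integer `q ≥ 2` and every `0 < δ < θ_q` there is `n₀` such that for every `n ≥ n₀` some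
tricolored sum-free family in `(ℤ/q)ⁿ` has at least `(θ_q − δ)ⁿ` members ("for any `δ > 0`, and
`n` sufficiently large, there are tri-colored sum-free sets in `C_qⁿ` of size `(θ−δ)ⁿ`. Our
construction also works when `q` is not prime"; the guard `δ < θ_q` makes "of size `(θ−δ)ⁿ`"
meaningful, and "at least" is equivalent since sub-families stay sum-free). Together with BCCGNSU
Thm. 4.14 (`≤ 3 θ_qⁿ`, in tree) the tricolored sum-free capacity of `ℤ/q` is exactly `θ_q`.
[cite: KleinbergSawinSpeyer2018, Abstract and Theorem 2] -/
theorem kleinbergSawinSpeyer2018 :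
    ∀ q : ℕ, 2 ≤ q → ∀ δ : ℝ, 0 < δ → δ < kssTheta q → ∃ n₀ : ℕ, ∀ n : ℕ, n₀ ≤ n →
      ∃ (s : ℕ) (x y z : Fin s → (Fin n → ZMod q)), IsTricoloredSumFree x y z ∧
        (kssTheta q - δ) ^ n ≤ (s : ℝ) :=
  fun q hq δ hδ hδθ => KleinbergSawinSpeyer.lower_bound q hq δ hδ hδθ

/-- The case `q = 2` (`θ₂ = 3/2^{2/3} = 1.88988…`, the tricolored sum-free capacity of `𝔽₂ⁿ`;
KSS with `q = 2`, Fu–Kleinberg 2014 / Coppersmith–Winograd): for `0 < δ < 3/2^{2/3}` and all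
large `n` there is a tricolored sum-free family in `(ℤ/2)ⁿ` of size at least `(3/2^{2/3} − δ)ⁿ`.
[cite: KleinbergSawinSpeyer2018, Theorem 2 (q = 2)] -/
theorem kleinbergSawinSpeyer2018_two {δ : ℝ} (hδ : 0 < δ) (hδ' : δ < 3 / (2:ℝ) ^ (2 / 3 : ℝ)) :
    ∃ n₀ : ℕ, ∀ n : ℕ, n₀ ≤ n →
      ∃ (s : ℕ) (x y z : Fin s → (Fin n → ZMod 2)), IsTricoloredSumFree x y z ∧
        (3 / (2:ℝ) ^ (2 / 3 : ℝ) - δ) ^ n ≤ (s : ℝ) := by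
  have h := kleinbergSawinSpeyer2018 2 le_rfl δ hδ (by rw [kssTheta_two]; exact hδ')
  rw [kssTheta_two] at h
  exact h


end Literature.Combinatorics.Additive

end
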